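import Mathlib.Tactic

/-!
# Kernel reflection for large polynomial identities (cell `pub-zeta5`, certifier `cert-1`)

HONEST FRAMING: systematic search; no irrationality claim unless certified.

Tooling for replaying creative-telescoping certificates whose polynomial data are too large for `ring`:
polynomials are written as `Lean.Grind.CommRing.Expr` syntax trees (Lean core's reflected ring expressions)
and evaluated by `peval e l` (= `Expr.denote` in the context `i ↦ l[i]`, with the ring structure of a Mathlib
`CommRing` pinned). This file supplies the glue — `peval` unfolding lemmas on constructors, simultaneous
substitution of variables with its evaluation lemma, a context-change lemma, a compact monomial syntax for
data polynomials in three variables, and the structural decision `peval_eq_of_toPoly_eq` (kernel normal forms,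
for SMALL trees). Large identities are decided by one big-integer evaluation in `Certificates/PolyKronecker.lean`.
No mathematics specific to the ζ(5) search lives here.
-/

namespace Summit.KontsevichZagierPeriods.Zeta5Search.Certificates

namespace PolyReflect

open Lean.Grind.CommRing (Expr Var Context Poly)

/-! ### Contexts from lists and pinned evaluation -/

section Ctx

variable {α : Type*} [CommRing α]

/-- Auxiliary: a right comb `RArray` holding the list `l`, whose first entry sits at index `s`. -/
def ctxGo (s : ℕ) : List α → Lean.RArray α
  | [] => .leaf 0
  | [a] => .leaf a
  | a :: b :: l => .branch (s + 1) (.leaf a) (ctxGo (s + 1) (b :: l))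

/-- The context (variable assignment) `i ↦ l[i]` (entries past the end are irrelevant). -/
def ctx (l : List α) : Context α := ctxGo 0 l

/-- **Evaluation** of a reflected expression at `vᵢ := l[i]`, in the Mathlib ring structure of `α`
(the `Lean.Grind.CommRing` structure used by `Expr.denote` is the one induced by `CommRing α`). -/
noncomputable def peval (e : Expr) (l : List α) : α :=
  @Expr.denote α (Ring.toGrindRing α) (ctx l) e

/-- Value of the variable `i` (for concrete `l` and `i`, `pvar l i = l[i]` holds by `rfl`). -/
def pvar (l : List α) (i : ℕ) : α := (ctx l).get i

end Ctx

/-! ### `peval` on constructors -/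

section Eval

variable {α : Type*} [CommRing α] (l : List α)

/-- `peval` of a numeral. -/
theorem peval_num (k : ℤ) : peval (Expr.num k) l = (k : α) :=
  @Lean.Grind.CommRing.denoteInt_eq α (Ring.toGrindRing α) k
/-- `peval` of a variable. -/
theorem peval_var (i : Var) : peval (Expr.var i) l = pvar l i := rfl
/-- `peval` of a negation. -/
theorem peval_neg (a : Expr) : peval (Expr.neg a) l = -peval a l := rfl
/-- `peval` of a sum. -/
theorem peval_add (a b : Expr) : peval (Expr.add a b) l = peval a l + peval b l := rfl
/-- `peval` of a difference. -/
theorem peval_sub (a b : Expr) : peval (Expr.sub a b) l = peval a l - peval b l := rfl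
/-- `peval` of a product. -/
theorem peval_mul (a b : Expr) : peval (Expr.mul a b) l = peval a l * peval b l := rfl
/-- `peval` of a power. -/
theorem peval_pow (a : Expr) (k : ℕ) : peval (Expr.pow a k) l = peval a l ^ k := rfl
/-- `peval` of a natural-number cast. -/
theorem peval_natCast (k : ℕ) : peval (Expr.natCast k) l = (k : α) := rfl
/-- `peval` of an integer cast. -/
theorem peval_intCast (k : ℤ) : peval (Expr.intCast k) l = (k : α) := rfl

/-- **Structural decision** (kernel normal forms): equal `toPoly` normal forms imply equal values. Use
`(by decide +kernel)` for the hypothesis; intended for SMALL trees. -/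
theorem peval_eq_of_toPoly_eq (a b : Expr) (h : (a.toPoly == b.toPoly) = true) : peval a l = peval b l :=
  @Expr.eq_of_toPoly_eq α (CommRing.toGrindCommRing α) (ctx l) a b h

end Eval

/-! ### Substitution of variables by expressions -/

/-- Simultaneous substitution `var i ↦ σ i`. -/
def substs (σ : ℕ → Expr) : Expr → Expr
  | .num k => .num k
  | .natCast k => .natCast k
  | .intCast k => .intCast k
  | .var i => σ i
  | .neg a => .neg (substs σ a)
  | .add a b => .add (substs σ a) (substs σ b)
  | .sub a b => .sub (substs σ a) (substs σ b)
  | .mul a b => .mul (substs σ a) (substs σ b)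
  | .pow a k => .pow (substs σ a) k

/-- All variables of `e` are `< N`. -/
def varsLT (N : ℕ) : Expr → Bool
  | .num _ => true
  | .natCast _ => true
  | .intCast _ => true
  | .var i => decide (i < N)
  | .neg a => varsLT N a
  | .add a b => varsLT N a && varsLT N b
  | .sub a b => varsLT N a && varsLT N b
  | .mul a b => varsLT N a && varsLT N b
  | .pow a _ => varsLT N a

section Substs

variable {α : Type*} [CommRing α]

/-- **Substitution lemma**: if the variables of `e` are `< N` and `l'` assigns to each such variable the
`l`-value of its substitute, then `peval (substs σ e) l = peval e l'`. -/
theorem peval_substs (σ : ℕ → Expr) (N : ℕ) (l l' : List α)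
    (h : ∀ i, i < N → pvar l' i = peval (σ i) l) :
    ∀ e : Expr, varsLT N e = true → peval (substs σ e) l = peval e l'
  | .num k, _ => rfl
  | .natCast k, _ => rfl
  | .intCast k, _ => rfl
  | .var i, hv => by
      simp only [varsLT, decide_eq_true_eq] at hv
      rw [substs, peval_var, h i hv]
  | .neg a, hv => by
      simp only [varsLT] at hv
      rw [substs, peval_neg, peval_neg, peval_substs σ N l l' h a hv]
  | .add a b, hv => by
      simp only [varsLT, Bool.and_eq_true] at hv
      rw [substs, peval_add, peval_add, peval_substs σ N l l' h a hv.1, peval_substs σ N l l' h b hv.2]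
  | .sub a b, hv => by
      simp only [varsLT, Bool.and_eq_true] at hv
      rw [substs, peval_sub, peval_sub, peval_substs σ N l l' h a hv.1, peval_substs σ N l l' h b hv.2]
  | .mul a b, hv => by
      simp only [varsLT, Bool.and_eq_true] at hv
      rw [substs, peval_mul, peval_mul, peval_substs σ N l l' h a hv.1, peval_substs σ N l l' h b hv.2]
  | .pow a k, hv => by
      simp only [varsLT] at hv
      rw [substs, peval_pow, peval_pow, peval_substs σ N l l' h a hv]

/-- Substituting each variable by itself is the identity. -/
theorem substs_var : ∀ e : Expr, substs (fun i => .var i) e = e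
  | .num _ => rfl
  | .natCast _ => rfl
  | .intCast _ => rfl
  | .var _ => rfl
  | .neg a => by rw [substs, substs_var a]
  | .add a b => by rw [substs, substs_var a, substs_var b]
  | .sub a b => by rw [substs, substs_var a, substs_var b]
  | .mul a b => by rw [substs, substs_var a, substs_var b]
  | .pow a k => by rw [substs, substs_var a]

/-- **Context change**: an expression with variables `< N` has equal values in contexts agreeing below `N`. -/
theorem peval_congr (N : ℕ) (l l' : List α) (h : ∀ i, i < N → pvar l' i = pvar l i)
    (e : Expr) (hv : varsLT N e = true) : peval e l = peval e l' := by
  have := peval_substs (fun i => .var i) N l l' (fun i hi => by rw [peval_var]; exact h i hi) e hv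
  rwa [substs_var] at this

end Substs

/-! ### Compact syntax for data polynomials in three variables -/

/-- The monomial `c · v₀^a · v₁^b · v₂^d`. -/
def M (c : ℤ) (a b d : ℕ) : Expr :=
  .mul (.num c) (.mul (.pow (.var 0) a) (.mul (.pow (.var 1) b) (.pow (.var 2) d)))

/-- Sum of two reflected expressions (short name for balanced data trees). -/
abbrev A (a b : Expr) : Expr := .add a b

/-- Value of `M c a b d`. -/
theorem peval_M {α : Type*} [CommRing α] (l : List α) (c : ℤ) (a b d : ℕ) :
    peval (M c a b d) l = (c : α) * (pvar l 0 ^ a * (pvar l 1 ^ b * pvar l 2 ^ d)) := by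
  rw [M, peval_mul, peval_num, peval_mul, peval_pow, peval_var, peval_mul, peval_pow, peval_var,
    peval_pow, peval_var]

/-! ### Smoke tests (also document the intended use) -/

/-- `(v₀ + v₁)²` reflected. -/
private def exSq : Expr := .pow (.add (.var 0) (.var 1)) 2
/-- `v₀² + 2v₀v₁ + v₁²` reflected. -/
private def exExp : Expr := A (A (M 1 2 0 0) (M 2 1 1 0)) (M 1 0 2 0)

/-- The structural mechanism end to end on `(a+b)² = a² + 2ab + b²`. -/
example (a b c : ℚ) : (a + b) ^ 2 = a ^ 2 + 2 * a * b + b ^ 2 := by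
  have h := peval_eq_of_toPoly_eq [a, b, c] exSq exExp (by decide +kernel)
  have d0 : pvar [a, b, c] 0 = a := rfl
  have d1 : pvar [a, b, c] 1 = b := rfl
  simp only [exSq, exExp, A, peval_pow, peval_add, peval_var, peval_M, d0, d1] at h
  push_cast at h
  linear_combination h

/-- Substitution end to end: `v₂ ↦ v₂ + 1` in `v₂²`. -/
example (a b c : ℚ) : (c + 1) ^ 2 = c ^ 2 + 2 * c + 1 := by
  let τ : ℕ → Expr := fun i => if i = 2 then .add (.var 2) (.num 1) else .var i
  have d2 : pvar [a, b, c] 2 = c := rfl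
  have hs := peval_substs τ 3 [a, b, c] [a, b, c + 1]
    (fun i hi => by
      interval_cases i
      · rfl
      · rfl
      · show c + 1 = peval (.add (.var 2) (.num 1)) _
        rw [peval_add, peval_var, peval_num, d2]; push_cast; ring) (M 1 0 0 2) (by decide)
  have h := peval_eq_of_toPoly_eq [a, b, c] (substs τ (M 1 0 0 2)) (A (A (M 1 0 0 2) (M 2 0 0 1)) (M 1 0 0 0))
    (by decide +kernel)
  rw [hs] at h
  have d2' : pvar [a, b, c + 1] 2 = c + 1 := rfl
  simp only [A, peval_M, peval_add, d2, d2'] at h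
  push_cast at h
  linear_combination h

end PolyReflect

end Summit.KontsevichZagierPeriods.Zeta5Search.Certificates
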